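import Literature.Analysis.PDE.PoissonKernelBall
import Literature.Analysis.PDE.LoewnerNirenbergFacts
import Mathlib.Analysis.InnerProductSpace.Projection.Reflection
import HarnessLib

/-!
# The Poisson kernel of a ball in a finite-dimensional real inner product space, II:
# the Poisson operator and the Dirichlet problem for the Laplacian on balls

Analysis/PDE support file (definitions with bodies and PROVED theorems only; no named facts) on
the discharge path of `Literature.Analysis.PDE.LoewnerNirenberg.exists_isMaximalSolution`.
Perron's method needs, on small balls `B(c, R)`, the solution of `Δh = 0` in `B`, `h = ψ` on
`∂B` for continuous `ψ`; it is produced here by a POISSON OPERATOR that avoids surface measure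
altogether: the sphere is parametrised by DIRECTIONS `y/‖y‖` of the points `y` of a fixed
annulus `A = {1 < ‖y‖ < 2}`, and the Poisson integral becomes a Haar-volume integral,

  `P ψ (x) = N⁻¹ ∫_A K_R(x - c, R y/‖y‖) ψ(c + R y/‖y‖) dy`,  `x ∈ B(c, R)`,

with `K_R(ξ, ζ) = (R² - ‖ξ‖²)‖ξ - ζ‖^{-n}` (`PoissonBall.kernelFn`) and the SELF-NORMALISATION
`N = ∫_A K_R(0, R y/‖y‖) dy` (`PoissonBall.normalizer`), and `P ψ = ψ` off the open ball.

* `rawOp`, `normalizer`, `poisson` (the definitions); `poisson_eq_of_mem_ball`,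
  `poisson_eq_self_of_notMem`.
* **smoothness and harmonicity inside** (`contDiffOn_rawOp`, `laplacian_rawOp_eq_zero`,
  `contDiffOn_poisson`, `laplacian_poisson_eq_zero`): on `B(c, R - δ)` the operator is the smooth
  parametric integral of `PoissonKernelBall.lean` against the globally smooth floored kernel, and
  `Δ_ξ K_R(·, ζ) = 0` (`PoissonBall.laplacian_kernelFn_eq_zero`).
* **normalisation** (`rawOp_one_eq_normalizer`): `x ↦ ∫_A K_R(x - c, ·)` is harmonic in the ball
  and RADIAL (Haar measure and the annulus are invariant under the reflection taking `x - c` to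
  any `x' - c` of the same norm, Mathlib's `Submodule.reflection_sub`), hence constant on every
  closed ball `B̄(c, r)`, `r < R`, by the weak maximum principle (`le_of_frontier_le`, proved
  here from the second-order condition at an interior maximum,
  `LoewnerNirenberg.laplacian_nonpos_of_isLocalMax`); `normalizer_pos`.
* **the maximum principle bounds** `m ≤ ψ ≤ M on ∂B ⇒ m ≤ P ψ ≤ M` (`poisson_le`, `le_poisson`,
  `abs_poisson_le`), linearity (`poisson_sub`);
* **boundary continuity** (`continuousOn_poisson`): `P ψ` is continuous on `B̄(c, R)` when `ψ`
  is continuous on the sphere (approximate-identity argument with the explicit kernel bound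
  `K_R(ξ, ζ) ≤ (R² - ‖ξ‖²) δ^{-n}` for `‖ξ - ζ‖ ≥ δ`);
* **interior gradient bound** (`exists_norm_fderiv_poisson_le`): `‖D(P ψ)(x)‖ ≤ C sup_∂B |ψ|`
  on `B̄(c, r)`, `r < R`, with `C` depending only on `c, R, r`;
* **representation** (`eq_poisson_of_harmonic`): a function continuous on `B̄(c, R)`, `C²` and
  harmonic in `B(c, R)` equals `P` of its boundary values (uniqueness by the weak maximum
  principle) — Gilbarg–Trudinger Thm. 2.6 for the ball, in this normalisation-free form.

## References

* D. Gilbarg, N. S. Trudinger, *Elliptic Partial Differential Equations of Second Order*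
  (Springer 2001), §2.5 (2.29), Thm. 2.6, Thm. 3.1. [GilbargTrudinger2001]
-/

noncomputable section

open MeasureTheory Metric Set Filter Function Module InnerProductSpace
open scoped Laplacian RealInnerProductSpace Topology ContDiff

namespace Literature.Analysis.PDE

namespace PoissonBall

variable {E : Type*} [NormedAddCommGroup E] [InnerProductSpace ℝ E] [FiniteDimensional ℝ E]
  [MeasurableSpace E] [BorelSpace E]

/-! ### Directions and the annulus -/

/-- The direction `y/‖y‖` of `y` (junk `0` at `y = 0`). [folklore] -/
def dir (y : E) : E := ‖y‖⁻¹ • y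

/-- The ANNULUS `{1 < ‖y‖ < 2}` whose points parametrise the directions. [folklore] -/
def annulus : Set E := {y | 1 < ‖y‖ ∧ ‖y‖ < 2}

omit [FiniteDimensional ℝ E] [MeasurableSpace E] [BorelSpace E] in
/-- `‖dir y‖ = 1` for `y ≠ 0`. [folklore] -/
theorem norm_dir {y : E} (hy : y ≠ 0) : ‖dir y‖ = 1 := by
  rw [dir, norm_smul, norm_inv, norm_norm, inv_mul_cancel₀ (norm_ne_zero_iff.2 hy)]

omit [FiniteDimensional ℝ E] [MeasurableSpace E] [BorelSpace E] in
/-- `‖dir y‖ ≤ 1` always. [folklore] -/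
theorem norm_dir_le_one (y : E) : ‖dir y‖ ≤ 1 := by
  by_cases hy : y = 0
  · simp [dir, hy]
  · exact (norm_dir hy).le

omit [InnerProductSpace ℝ E] [FiniteDimensional ℝ E] [MeasurableSpace E] [BorelSpace E] in
/-- Points of the annulus are nonzero. [folklore] -/
theorem ne_zero_of_mem_annulus {y : E} (hy : y ∈ annulus) : y ≠ 0 := by
  rintro rfl
  norm_num [annulus] at hy

omit [InnerProductSpace ℝ E] [FiniteDimensional ℝ E] [MeasurableSpace E] [BorelSpace E] in
/-- The annulus is open. [folklore] -/
theorem isOpen_annulus : IsOpen (annulus : Set E) :=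
  (isOpen_lt continuous_const continuous_norm).inter (isOpen_lt continuous_norm continuous_const)

omit [InnerProductSpace ℝ E] [FiniteDimensional ℝ E] [BorelSpace E] in
/-- The annulus is measurable. [folklore] -/
theorem measurableSet_annulus [OpensMeasurableSpace E] : MeasurableSet (annulus : Set E) :=
  isOpen_annulus.measurableSet

omit [InnerProductSpace ℝ E] [FiniteDimensional ℝ E] [MeasurableSpace E] [BorelSpace E] in
/-- The annulus lies in the ball `B(0, 2)`. [folklore] -/
theorem annulus_subset_ball : (annulus : Set E) ⊆ ball 0 2 := fun y hy => by
  rw [mem_ball_zero_iff]; exact hy.2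

/-- The annulus has finite measure. [folklore] -/
theorem volume_annulus_lt_top : volume (annulus : Set E) < ⊤ :=
  (measure_mono annulus_subset_ball).trans_lt measure_ball_lt_top

/-- The annulus has positive measure (it is open and nonempty, `n ≥ 1`). [folklore] -/
theorem volume_annulus_pos (hn : 0 < finrank ℝ E) : 0 < volume (annulus : Set E) := by
  haveI : Nontrivial E := Module.nontrivial_of_finrank_pos (R := ℝ) hn
  obtain ⟨e, he⟩ : ∃ e : E, ‖e‖ = 1 := exists_norm_eq E zero_le_one
  refine isOpen_annulus.measure_pos volume ⟨(3 / 2 : ℝ) • e, ?_⟩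
  simp only [annulus, mem_setOf_eq, norm_smul, he, mul_one, Real.norm_eq_abs]
  constructor <;> norm_num

omit [FiniteDimensional ℝ E] [MeasurableSpace E] [BorelSpace E] in
/-- `dir` is continuous on the annulus (indeed off the origin). [folklore] -/
theorem continuousOn_dir : ContinuousOn (dir : E → E) annulus := by
  intro y hy
  have hy0 := ne_zero_of_mem_annulus hy
  exact ((continuousAt_id.norm.inv₀ (norm_ne_zero_iff.2 hy0)).smul continuousAt_id).continuousWithinAt

omit [FiniteDimensional ℝ E] [MeasurableSpace E] [BorelSpace E] in
/-- The boundary point `c + R • dir y` lies on the sphere `S(c, R)` (`R ≥ 0`, `y ≠ 0`).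
[folklore] -/
theorem sph_mem_sphere (c : E) {R : ℝ} (hR : 0 ≤ R) {y : E} (hy : y ≠ 0) :
    c + R • dir y ∈ sphere c R := by
  rw [mem_sphere, dist_eq_norm, add_sub_cancel_left, norm_smul, norm_dir hy, mul_one,
    Real.norm_eq_abs, abs_of_nonneg hR]

omit [FiniteDimensional ℝ E] [MeasurableSpace E] [BorelSpace E] in
/-- Under a linear isometry, `dir (L y) = L (dir y)`. [folklore] -/
theorem dir_map (L : E ≃ₗᵢ[ℝ] E) (y : E) : dir (L y) = L (dir y) := by
  simp [dir]

/-! ### The operator -/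

/-- The RAW Poisson operator `∫_A K_R(x - c, R dir y) ψ(c + R dir y) dy`. [folklore] -/
def rawOp (c : E) (R : ℝ) (ψ : E → ℝ) (x : E) : ℝ :=
  ∫ y in annulus, kernelFn R (x - c) (R • dir y) * ψ (c + R • dir y)

/-- The SELF-NORMALISATION `N = ∫_A K_R(0, R dir y) dy` (the raw operator of `ψ ≡ 1` at the
centre; `N = |A| R^{2-n}`). [folklore] -/
def normalizer (c : E) (R : ℝ) : ℝ := rawOp c R (fun _ => 1) c

/-- **THE POISSON OPERATOR OF THE BALL `B(c, R)`**: `P ψ = N⁻¹ · rawOp ψ` on the open ball and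
`P ψ = ψ` elsewhere (so `P ψ` carries the boundary values `ψ` on the sphere). For continuous
`ψ` it is the solution of the Dirichlet problem `Δh = 0` in `B`, `h = ψ` on `∂B`
(Gilbarg–Trudinger Thm. 2.6, Poisson integral formula, in a surface-measure-free normalisation).
[cite: GilbargTrudinger2001, Thm. 2.6] -/
def poisson (c : E) (R : ℝ) (ψ : E → ℝ) (x : E) : ℝ :=
  open scoped Classical in
  if x ∈ ball c R then rawOp c R ψ x / normalizer c R else ψ x

/-- On the ball, `P ψ x = rawOp ψ x / N`. [folklore] -/
theorem poisson_eq_of_mem_ball {c : E} {R : ℝ} (ψ : E → ℝ) {x : E} (hx : x ∈ ball c R) :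
    poisson c R ψ x = rawOp c R ψ x / normalizer c R := by
  unfold poisson; rw [if_pos hx]

/-- Off the ball, `P ψ x = ψ x`. [folklore] -/
theorem poisson_eq_self_of_notMem {c : E} {R : ℝ} (ψ : E → ℝ) {x : E} (hx : x ∉ ball c R) :
    poisson c R ψ x = ψ x := by
  unfold poisson; rw [if_neg hx]

/-- On the sphere, `P ψ = ψ`. [folklore] -/
theorem poisson_eq_self_of_mem_sphere {c : E} {R : ℝ} (ψ : E → ℝ) {x : E} (hx : x ∈ sphere c R) :
    poisson c R ψ x = ψ x :=
  poisson_eq_self_of_notMem ψ fun h => by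
    rw [mem_sphere] at hx; rw [mem_ball] at h; linarith

/-! ### Boundary data: measurability and integrability on the annulus -/

section Data

variable {c : E} {R : ℝ} {ψ : E → ℝ}

omit [FiniteDimensional ℝ E] [MeasurableSpace E] [BorelSpace E] in
/-- The pulled-back boundary data `y ↦ ψ (c + R dir y)` is continuous on the annulus when `ψ`
is continuous on the sphere (`R ≥ 0`). [folklore] -/
theorem continuousOn_data (hR : 0 ≤ R) (hψ : ContinuousOn ψ (sphere c R)) :
    ContinuousOn (fun y : E => ψ (c + R • dir y)) annulus := by
  refine hψ.comp (continuousOn_const.add (continuousOn_const.smul continuousOn_dir)) ?_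
  exact fun y hy => sph_mem_sphere c hR (ne_zero_of_mem_annulus hy)

/-- The pulled-back data is a.e. strongly measurable on the annulus. [folklore] -/
theorem aestronglyMeasurable_data (hR : 0 ≤ R) (hψ : ContinuousOn ψ (sphere c R)) :
    AEStronglyMeasurable (fun y : E => ψ (c + R • dir y)) (volume.restrict annulus) :=
  (continuousOn_data hR hψ).aestronglyMeasurable measurableSet_annulus

/-- The pulled-back data is integrable on the annulus when `|ψ| ≤ M` on the sphere. [folklore] -/
theorem integrable_data (hR : 0 ≤ R) (hψ : ContinuousOn ψ (sphere c R)) {M : ℝ}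
    (hM : ∀ ζ ∈ sphere c R, |ψ ζ| ≤ M) :
    Integrable (fun y : E => ψ (c + R • dir y)) (volume.restrict annulus) := by
  haveI : IsFiniteMeasure (volume.restrict (annulus : Set E)) :=
    ⟨by rw [Measure.restrict_apply_univ]; exact volume_annulus_lt_top⟩
  refine Integrable.of_bound (aestronglyMeasurable_data hR hψ) M ?_
  rw [ae_restrict_iff' measurableSet_annulus]
  refine Eventually.of_forall fun y hy => ?_
  rw [Real.norm_eq_abs]
  exact hM _ (sph_mem_sphere c hR (ne_zero_of_mem_annulus hy))

/-- `dir` is a.e. strongly measurable on the annulus and bounded by `1`. [folklore] -/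
theorem aestronglyMeasurable_dir :
    AEStronglyMeasurable (dir : E → E) (volume.restrict annulus) ∧
      ∀ᵐ y ∂(volume.restrict (annulus : Set E)), ‖dir y‖ ≤ 1 :=
  ⟨continuousOn_dir.aestronglyMeasurable measurableSet_annulus,
    Eventually.of_forall fun y => norm_dir_le_one y⟩

omit [MeasurableSpace E] [BorelSpace E] in
/-- A function continuous on the sphere is bounded there. [folklore] -/
theorem exists_bound_sphere (hψ : ContinuousOn ψ (sphere c R)) : ∃ M : ℝ, ∀ ζ ∈ sphere c R, |ψ ζ| ≤ M := by
  obtain ⟨M, hM⟩ := (isCompact_sphere c R).exists_bound_of_continuousOn hψ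
  exact ⟨M, fun ζ hζ => by simpa [Real.norm_eq_abs] using hM ζ hζ⟩

end Data

/-! ### The smooth floored kernel and the representation of `rawOp` inside the ball -/

section Smooth

variable {c : E} {R : ℝ} {ψ : E → ℝ}

/-- The jointly smooth floored kernel `A_m(x, θ) = (R² - ‖x - c‖²)(smoothFloor m ‖x - c - Rθ‖²)^{-n/2}`.
[folklore] -/
def smoothKer (c : E) (R m : ℝ) (q : E × E) : ℝ :=
  (R ^ 2 - ‖q.1 - c‖ ^ 2) * (Newtonian.smoothFloor m (‖q.1 - c - R • q.2‖ ^ 2)) ^ (-halfDim E)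

omit [FiniteDimensional ℝ E] [MeasurableSpace E] [BorelSpace E] in
/-- The floored kernel is smooth (`m > 0`). [folklore] -/
theorem contDiff_smoothKer (c : E) (R : ℝ) {m : ℝ} (hm : 0 < m) : ContDiff ℝ ∞ (smoothKer c R m) := by
  unfold smoothKer
  have h1 : ContDiff ℝ ∞ fun q : E × E => q.1 - c := contDiff_fst.sub contDiff_const
  have h2 : ContDiff ℝ ∞ fun q : E × E => q.1 - c - R • q.2 := h1.sub (contDiff_snd.const_smul R)
  refine (contDiff_const.sub ((contDiff_norm_sq ℝ).comp h1)).mul ?_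
  have h3 : ContDiff ℝ ∞ fun q : E × E => Newtonian.smoothFloor m (‖q.1 - c - R • q.2‖ ^ 2) :=
    (Newtonian.contDiff_smoothFloor m).comp ((contDiff_norm_sq ℝ).comp h2)
  exact h3.rpow_const_of_ne fun q => (hm.trans_le (Newtonian.le_smoothFloor hm _)).ne'

omit [FiniteDimensional ℝ E] [MeasurableSpace E] [BorelSpace E] in
/-- Inside `B(c, R - δ)` and for unit `θ`, the floored kernel with `m = δ²/2` IS the Poisson
kernel: `A_m(x, θ) = K_R(x - c, Rθ)`. [folklore] -/
theorem smoothKer_eq_kernelFn {δ : ℝ} (hδ : 0 < δ) {x : E} (hx : x ∈ ball c (R - δ)) {θ : E}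
    (hθ : ‖θ‖ = 1) : smoothKer c R (δ ^ 2 / 2) (x, θ) = kernelFn R (x - c) (R • θ) := by
  have hR : δ < R := by
    have := (mem_ball.1 hx).trans_le le_rfl
    have h0 : (0 : ℝ) ≤ dist x c := dist_nonneg
    linarith
  have hdist : δ < ‖x - c - R • θ‖ := by
    rw [mem_ball, dist_eq_norm] at hx
    have h1 : ‖R • θ‖ = R := by rw [norm_smul, hθ, mul_one, Real.norm_eq_abs, abs_of_pos (hδ.trans hR)]
    have h2 : ‖R • θ‖ ≤ ‖x - c - R • θ‖ + ‖x - c‖ := by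
      have := norm_sub_le (x - c) (x - c - R • θ)
      rw [sub_sub_cancel] at this
      linarith [norm_sub_rev (x - c) (x - c - R • θ)]
    linarith
  have h2m : 2 * (δ ^ 2 / 2) ≤ ‖x - c - R • θ‖ ^ 2 := by nlinarith [norm_nonneg (x - c - R • θ)]
  simp only [smoothKer, kernelFn]
  rw [Newtonian.smoothFloor_eq_self (by positivity) h2m]

omit [FiniteDimensional ℝ E] [MeasurableSpace E] [BorelSpace E] in
/-- The same agreement holds on a neighbourhood (in `x`), so the `x`-Laplacians agree.
[folklore] -/
theorem smoothKer_eventuallyEq {δ : ℝ} (hδ : 0 < δ) {x : E} (hx : x ∈ ball c (R - δ)) {θ : E}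
    (hθ : ‖θ‖ = 1) :
    (fun w : E => smoothKer c R (δ ^ 2 / 2) (w, θ)) =ᶠ[𝓝 x] fun w => kernelFn R (w - c) (R • θ) := by
  filter_upwards [isOpen_ball.mem_nhds hx] with w hw using smoothKer_eq_kernelFn hδ hw hθ

/-- **Representation inside**: for `x ∈ B(c, R - δ)`,
`rawOp ψ x = ∫ A_{δ²/2}(x, dir y) ψ(c + R dir y) d(vol|_A)(y)`. [folklore] -/
theorem rawOp_eq_integral_smoothKer {δ : ℝ} (hδ : 0 < δ) {x : E} (hx : x ∈ ball c (R - δ)) :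
    rawOp c R ψ x =
      ∫ y, smoothKer c R (δ ^ 2 / 2) (x, dir y) * ψ (c + R • dir y) ∂(volume.restrict annulus) := by
  unfold rawOp
  refine setIntegral_congr_fun measurableSet_annulus fun y hy => ?_
  rw [smoothKer_eq_kernelFn hδ hx (norm_dir (ne_zero_of_mem_annulus hy))]

/-- **`rawOp ψ` is smooth on the open ball** (for `ψ` continuous on the sphere). [folklore] -/
theorem contDiffOn_rawOp (hR : 0 < R) (hψ : ContinuousOn ψ (sphere c R)) :
    ContDiffOn ℝ ∞ (rawOp c R ψ) (ball c R) := by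
  obtain ⟨M, hM⟩ := exists_bound_sphere hψ
  intro x hx
  -- choose `δ` with `x ∈ B(c, R - δ)`
  obtain ⟨δ, hδ, hxδ⟩ : ∃ δ : ℝ, 0 < δ ∧ x ∈ ball c (R - δ) := by
    refine ⟨(R - dist x c) / 2, by rw [mem_ball] at hx; linarith, ?_⟩
    rw [mem_ball] at hx ⊢; linarith
  have hsm := contDiff_integral_kernel_mul_real (contDiff_smoothKer c R (by positivity : (0:ℝ) < δ ^ 2 / 2))
    aestronglyMeasurable_dir.1 aestronglyMeasurable_dir.2 (integrable_data hR.le hψ hM)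
  have hev : rawOp c R ψ =ᶠ[𝓝 x]
      fun x => ∫ y, smoothKer c R (δ ^ 2 / 2) (x, dir y) * ψ (c + R • dir y) ∂(volume.restrict annulus) := by
    filter_upwards [isOpen_ball.mem_nhds hxδ] with w hw using rawOp_eq_integral_smoothKer hδ hw
  exact ((hsm.contDiffAt.congr_of_eventuallyEq hev).contDiffWithinAt).mono_of_mem_nhdsWithin
    (mem_nhdsWithin_of_mem_nhds (isOpen_ball.mem_nhds hx))

/-- **`Δ (rawOp ψ) = 0` on the open ball** (harmonicity of the kernel in `x`). [folklore] -/
theorem laplacian_rawOp_eq_zero (hR : 0 < R) (hψ : ContinuousOn ψ (sphere c R)) {x : E}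
    (hx : x ∈ ball c R) : (Δ (rawOp c R ψ)) x = 0 := by
  obtain ⟨M, hM⟩ := exists_bound_sphere hψ
  obtain ⟨δ, hδ, hxδ⟩ : ∃ δ : ℝ, 0 < δ ∧ x ∈ ball c (R - δ) := by
    refine ⟨(R - dist x c) / 2, by rw [mem_ball] at hx; linarith, ?_⟩
    rw [mem_ball] at hx ⊢; linarith
  have hm : (0 : ℝ) < δ ^ 2 / 2 := by positivity
  have hA := contDiff_smoothKer c R hm
  have hev : rawOp c R ψ =ᶠ[𝓝 x]
      fun x => ∫ y, smoothKer c R (δ ^ 2 / 2) (x, dir y) * ψ (c + R • dir y) ∂(volume.restrict annulus) := by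
    filter_upwards [isOpen_ball.mem_nhds hxδ] with w hw using rawOp_eq_integral_smoothKer hδ hw
  rw [(InnerProductSpace.laplacian_congr_nhds hev).eq_of_nhds,
    laplacian_integral_kernel_mul_real hA aestronglyMeasurable_dir.1 aestronglyMeasurable_dir.2
      (integrable_data hR.le hψ hM) x]
  refine integral_eq_zero_of_ae ?_
  refine Filter.eventuallyEq_of_mem (self_mem_ae_restrict measurableSet_annulus) fun y hy => ?_
  have hy0 := ne_zero_of_mem_annulus hy
  have hθ : ‖dir y‖ = 1 := norm_dir hy0
  simp only [Pi.zero_apply]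
  rw [← laplacian_curry_eq_kernelLaplacian hA x (dir y),
    (InnerProductSpace.laplacian_congr_nhds (smoothKer_eventuallyEq hδ hxδ hθ)).eq_of_nhds,
    LoewnerNirenberg.laplacian_translate_sub (fun w : E => kernelFn R w (R • dir y)) c x,
    laplacian_kernelFn_eq_zero _ _, zero_mul]
  · rw [norm_smul, hθ, mul_one, Real.norm_eq_abs, abs_of_pos hR]
  · intro h
    rw [mem_ball, dist_eq_norm] at hx
    have : ‖x - c‖ = R := by rw [h, norm_smul, hθ, mul_one, Real.norm_eq_abs, abs_of_pos hR]
    linarith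

end Smooth

/-! ### The weak maximum principle on bounded open sets -/

section MaximumPrinciple

omit [MeasurableSpace E] [BorelSpace E] in
/-- `Δ ‖y‖² = 2n`. [folklore] -/
theorem laplacian_norm_sq (y : E) : (Δ (fun w : E => ‖w‖ ^ 2)) y = 2 * (finrank ℝ E : ℝ) := by
  have hg : ∀ σ ∈ (univ : Set ℝ), HasDerivAt (fun τ : ℝ => τ) 1 σ := fun σ _ => hasDerivAt_id σ
  have key := Literature.Analysis.FluidPDE.laplacian_comp_norm_sq (E := E) (g := fun τ : ℝ => τ)
    isOpen_univ hg (z := y) (mem_univ _) (hasDerivAt_const _ _)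
  rw [show (fun w : E => ‖w‖ ^ 2) = fun w : E => (fun τ : ℝ => τ) (‖w‖ ^ 2) from rfl, key]
  ring

omit [MeasurableSpace E] [BorelSpace E] in
/-- **Weak maximum principle.** Let `D` be a bounded open set, `u` continuous on `closure D`,
twice continuously differentiable at the points of `D` with `Δu ≥ 0` there, and `u ≤ M` on the
frontier of `D`. Then `u ≤ M` on `closure D` (perturb by `ε‖y‖²` and use `Δ ≤ 0` at an interior
maximum; Gilbarg–Trudinger Thm. 3.1 for the Laplacian). [cite: GilbargTrudinger2001, Thm. 3.1] -/
theorem le_of_frontier_le (hn : 0 < finrank ℝ E) {D : Set E} (hD : IsOpen D)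
    (hDb : Bornology.IsBounded D) {u : E → ℝ} (huc : ContinuousOn u (closure D))
    (hu2 : ∀ x ∈ D, ContDiffAt ℝ 2 u x) (hΔ : ∀ x ∈ D, 0 ≤ (Δ u) x) {M : ℝ}
    (hM : ∀ x ∈ frontier D, u x ≤ M) : ∀ x ∈ closure D, u x ≤ M := by
  intro x hx
  have hK : IsCompact (closure D) := hDb.isCompact_closure
  obtain ⟨ρ, hρ⟩ := hK.isBounded.subset_closedBall 0
  have hρ' : ∀ y ∈ closure D, ‖y‖ ^ 2 ≤ ρ ^ 2 := fun y hy => by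
    have := hρ hy
    rw [mem_closedBall, dist_zero_right] at this
    exact pow_le_pow_left₀ (norm_nonneg _) this 2
  refine le_of_forall_pos_le_add fun η hη => ?_
  -- perturbation scale
  set ε : ℝ := η / (ρ ^ 2 + 1) with hε
  have hε0 : 0 < ε := by positivity
  set v : E → ℝ := fun y => u y + ε * ‖y‖ ^ 2 with hv
  have hvc : ContinuousOn v (closure D) := huc.add (continuousOn_const.mul (continuous_norm.pow 2).continuousOn)
  obtain ⟨y₀, hy₀, hmax⟩ := hK.exists_isMaxOn ⟨x, hx⟩ hvc
  -- the maximum point is on the frontier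
  have hy₀f : y₀ ∈ frontier D := by
    rw [hD.frontier_eq]
    refine ⟨hy₀, fun hy₀D => ?_⟩
    have hloc : IsLocalMax v y₀ :=
      hmax.isLocalMax (mem_of_superset (hD.mem_nhds hy₀D) subset_closure)
    have hsq : ContDiffAt ℝ 2 (fun y : E => ε * ‖y‖ ^ 2) y₀ :=
      (contDiff_const.mul (contDiff_norm_sq ℝ)).contDiffAt
    have hv2 : ContDiffAt ℝ 2 v y₀ := (hu2 y₀ hy₀D).add hsq
    have h1 := LoewnerNirenberg.laplacian_nonpos_of_isLocalMax hloc hv2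
    have h2 : (Δ v) y₀ = (Δ u) y₀ + ε * (2 * (finrank ℝ E : ℝ)) := by
      have e : v = u + fun y => ε * ‖y‖ ^ 2 := rfl
      rw [e, (hu2 y₀ hy₀D).laplacian_add hsq, Newtonian.laplacian_const_mul, laplacian_norm_sq]
    have h3 : (0 : ℝ) < finrank ℝ E := by exact_mod_cast hn
    have := hΔ y₀ hy₀D
    nlinarith
  -- conclude
  have h1 : v x ≤ v y₀ := hmax hx
  have h2 : u y₀ ≤ M := hM y₀ hy₀f
  have h3 : ε * ‖y₀‖ ^ 2 ≤ ε * ρ ^ 2 := mul_le_mul_of_nonneg_left (hρ' y₀ hy₀) hε0.le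
  have h4 : 0 ≤ ε * ‖x‖ ^ 2 := by positivity
  have h5 : ε * ρ ^ 2 ≤ η := by
    rw [hε, div_mul_eq_mul_div, div_le_iff₀ (by positivity)]
    nlinarith
  simp only [hv] at h1
  linarith

omit [MeasurableSpace E] [BorelSpace E] in
/-- The weak maximum principle for harmonic functions, two-sided: `|u| ≤ M` on the frontier
implies `|u| ≤ M` on the closure. [folklore] -/
theorem abs_le_of_frontier_abs_le (hn : 0 < finrank ℝ E) {D : Set E} (hD : IsOpen D)
    (hDb : Bornology.IsBounded D) {u : E → ℝ} (huc : ContinuousOn u (closure D))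
    (hu2 : ∀ x ∈ D, ContDiffAt ℝ 2 u x) (hΔ : ∀ x ∈ D, (Δ u) x = 0) {M : ℝ}
    (hM : ∀ x ∈ frontier D, |u x| ≤ M) : ∀ x ∈ closure D, |u x| ≤ M := by
  intro x hx
  rw [abs_le]
  constructor
  · have h := le_of_frontier_le hn hD hDb (u := -u) huc.neg (fun y hy => (hu2 y hy).neg)
      (fun y hy => by rw [InnerProductSpace.laplacian_neg, Pi.neg_apply, hΔ y hy, neg_zero])
      (M := M) (fun y hy => (neg_le_abs _).trans (hM y hy)) x hx
    simp only [Pi.neg_apply] at h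
    linarith
  · exact le_of_frontier_le hn hD hDb huc hu2 (fun y hy => (hΔ y hy).ge)
      (fun y hy => (le_abs_self _).trans (hM y hy)) x hx

end MaximumPrinciple

/-! ### Normalisation: `∫_A K_R(x - c, ·)` is constant on the ball -/

section Normalisation

variable {c : E} {R : ℝ}

/-- Rotation invariance of the raw operator of `ψ ≡ 1`: for a linear isometry `L`,
`rawOp 1 (c + L(x - c)) = rawOp 1 x` (Haar measure, the annulus and the kernel are
`L`-invariant). [folklore] -/
theorem rawOp_one_map (L : E ≃ₗᵢ[ℝ] E) (x : E) :
    rawOp c R (fun _ => 1) (c + L (x - c)) = rawOp c R (fun _ => 1) x := by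
  unfold rawOp
  simp only [mul_one, add_sub_cancel_left]
  have hL : MeasurePreserving L volume volume := L.measurePreserving
  have he : MeasurableEmbedding L := L.toHomeomorph.measurableEmbedding
  have hpre : L ⁻¹' (annulus : Set E) = annulus := by
    ext y; simp [annulus]
  have key := hL.setIntegral_preimage_emb he (fun y => kernelFn R (L (x - c)) (R • dir y)) annulus
  rw [hpre] at key
  rw [← key]
  refine setIntegral_congr_fun measurableSet_annulus fun y _ => ?_
  rw [dir_map, ← LinearIsometryEquiv.map_smul, kernelFn_map]

/-- The raw operator of `ψ ≡ 1` is RADIAL about `c`. [folklore] -/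
theorem rawOp_one_eq_of_norm_eq {x x' : E} (h : ‖x - c‖ = ‖x' - c‖) :
    rawOp c R (fun _ => 1) x = rawOp c R (fun _ => 1) x' := by
  set L : E ≃ₗᵢ[ℝ] E := (ℝ ∙ ((x - c) - (x' - c)))ᗮ.reflection with hL
  have hLx : L (x - c) = x' - c := Submodule.reflection_sub h
  have hx' : x' = c + L (x - c) := by rw [hLx, add_sub_cancel]
  rw [hx', rawOp_one_map]

/-- **The raw operator of `ψ ≡ 1` is constant on the ball, equal to the normaliser**
(harmonic + radial ⇒ constant on each `B̄(c, r)`, `r < R`, by the weak maximum principle).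
[folklore] -/
theorem rawOp_one_eq_normalizer (hn : 0 < finrank ℝ E) (hR : 0 < R) {x : E} (hx : x ∈ ball c R) :
    rawOp c R (fun _ => 1) x = normalizer c R := by
  unfold normalizer
  set N : E → ℝ := rawOp c R (fun _ => 1) with hN
  have hψ : ContinuousOn (fun _ : E => (1 : ℝ)) (sphere c R) := continuousOn_const
  have hNs : ContDiffOn ℝ ∞ N (ball c R) := contDiffOn_rawOp hR hψ
  have hNΔ : ∀ y ∈ ball c R, (Δ N) y = 0 := fun y hy => laplacian_rawOp_eq_zero hR hψ hy
  set r : ℝ := dist x c with hr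
  have hrR : r < R := hx
  rcases eq_or_lt_of_le (dist_nonneg : 0 ≤ r) with hr0 | hr0
  · have : x = c := dist_eq_zero.1 hr0.symm
    rw [this]
  -- the weak maximum principle on `D = ball c r`, in both directions
  have hD : IsOpen (ball c r) := isOpen_ball
  have hDb : Bornology.IsBounded (ball c r) := isBounded_ball
  have hcl : closure (ball c r) = closedBall c r := closure_ball c hr0.ne'
  have hfr : frontier (ball c r) = sphere c r := frontier_ball c hr0.ne'
  have hsub : closedBall c r ⊆ ball c R := closedBall_subset_ball hrR
  have hNc : ContinuousOn N (closure (ball c r)) := by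
    rw [hcl]; exact hNs.continuousOn.mono hsub
  have hN2 : ∀ y ∈ ball c r, ContDiffAt ℝ 2 N y := fun y hy =>
    (contDiffOn_infty.1 hNs 2).contDiffAt (isOpen_ball.mem_nhds (hsub (ball_subset_closedBall hy)))
  have hNΔ' : ∀ y ∈ ball c r, (Δ N) y = 0 := fun y hy => hNΔ y (hsub (ball_subset_closedBall hy))
  have hfrval : ∀ y ∈ frontier (ball c r), N y = N x := by
    intro y hy
    rw [hfr, mem_sphere, dist_eq_norm] at hy
    exact rawOp_one_eq_of_norm_eq (by rw [hy, hr, dist_eq_norm])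
  have hcmem : c ∈ closure (ball c r) := by rw [hcl]; exact mem_closedBall_self hr0.le
  have h1 : N c ≤ N x :=
    le_of_frontier_le hn hD hDb hNc hN2 (fun y hy => (hNΔ' y hy).ge) (fun y hy => (hfrval y hy).le) c hcmem
  have h2 : -N c ≤ -N x := by
    have := le_of_frontier_le hn hD hDb (u := -N) hNc.neg (fun y hy => (hN2 y hy).neg)
      (fun y hy => by rw [InnerProductSpace.laplacian_neg, Pi.neg_apply, hNΔ' y hy, neg_zero])
      (M := -N x) (fun y hy => by simp only [Pi.neg_apply]; rw [hfrval y hy]) c hcmem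
    simpa using this
  linarith

omit [FiniteDimensional ℝ E] [MeasurableSpace E] [BorelSpace E] in
/-- For `y` in the annulus, `‖R • dir y‖ = R` (`R ≥ 0`). [folklore] -/
theorem norm_smul_dir {R : ℝ} (hR : 0 ≤ R) {y : E} (hy : y ∈ annulus) : ‖R • dir y‖ = R := by
  rw [norm_smul, norm_dir (ne_zero_of_mem_annulus hy), mul_one, Real.norm_eq_abs, abs_of_nonneg hR]

/-- The value of the normaliser: `N = |A| · R² (R²)^{-n/2}`. [folklore] -/
theorem normalizer_eq (hR : 0 ≤ R) :
    normalizer c R = (volume : Measure E).real annulus * (R ^ 2 * (R ^ 2) ^ (-halfDim E)) := by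
  unfold normalizer rawOp
  simp only [sub_self, mul_one]
  have h : ∀ y ∈ (annulus : Set E), kernelFn R 0 (R • dir y) = R ^ 2 * (R ^ 2) ^ (-halfDim E) := by
    intro y hy
    rw [kernelFn_zero_left, norm_smul_dir hR hy]
  rw [setIntegral_congr_fun measurableSet_annulus h, setIntegral_const, smul_eq_mul]

/-- **The normaliser is positive** (`n ≥ 1`, `R > 0`). [folklore] -/
theorem normalizer_pos (hn : 0 < finrank ℝ E) (hR : 0 < R) : 0 < normalizer c R := by
  rw [normalizer_eq hR.le]
  have hV : 0 < (volume : Measure E).real annulus :=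
    ENNReal.toReal_pos (volume_annulus_pos hn).ne' volume_annulus_lt_top.ne
  have : 0 < R ^ 2 * (R ^ 2) ^ (-halfDim E) := mul_pos (by positivity) (Real.rpow_pos_of_pos (by positivity) _)
  exact mul_pos hV this

end Normalisation

/-! ### `P ψ` is smooth and harmonic in the ball -/

section Harmonic

variable {c : E} {R : ℝ} {ψ : E → ℝ}

/-- On the ball `P ψ` agrees with `N⁻¹ · rawOp ψ`. [folklore] -/
theorem poisson_eqOn_ball : EqOn (poisson c R ψ) (fun x => (normalizer c R)⁻¹ * rawOp c R ψ x) (ball c R) :=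
  fun x hx => by rw [poisson_eq_of_mem_ball ψ hx, div_eq_inv_mul]

/-- **`P ψ` is smooth on the open ball.** [folklore] -/
theorem contDiffOn_poisson (hR : 0 < R) (hψ : ContinuousOn ψ (sphere c R)) :
    ContDiffOn ℝ ∞ (poisson c R ψ) (ball c R) :=
  (contDiffOn_const.mul (contDiffOn_rawOp hR hψ)).congr poisson_eqOn_ball

/-- `P ψ` is `C²` at every point of the open ball. [folklore] -/
theorem contDiffAt_poisson (hR : 0 < R) (hψ : ContinuousOn ψ (sphere c R)) {x : E} (hx : x ∈ ball c R) :
    ContDiffAt ℝ 2 (poisson c R ψ) x :=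
  (contDiffOn_infty.1 (contDiffOn_poisson hR hψ) 2).contDiffAt (isOpen_ball.mem_nhds hx)

/-- **`Δ (P ψ) = 0` on the open ball.** [folklore] -/
theorem laplacian_poisson_eq_zero (hR : 0 < R) (hψ : ContinuousOn ψ (sphere c R)) {x : E}
    (hx : x ∈ ball c R) : (Δ (poisson c R ψ)) x = 0 := by
  have hev : poisson c R ψ =ᶠ[𝓝 x] fun x => (normalizer c R)⁻¹ * rawOp c R ψ x :=
    Filter.eventuallyEq_of_mem (isOpen_ball.mem_nhds hx) poisson_eqOn_ball
  rw [(InnerProductSpace.laplacian_congr_nhds hev).eq_of_nhds, Newtonian.laplacian_const_mul,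
    laplacian_rawOp_eq_zero hR hψ hx, mul_zero]

end Harmonic

/-! ### Integrability of the kernel on the annulus, linearity, and the maximum principle bounds -/

section Bounds

variable {c : E} {R : ℝ} {ψ ψ₁ ψ₂ : E → ℝ}

/-- For `x` in the open ball, `y ↦ K_R(x - c, R dir y)` is continuous on the annulus, bounded by
`(R² - ‖x-c‖²)((R - ‖x-c‖)²)^{-n/2}`, nonnegative, and integrable there. [folklore] -/
theorem kernel_on_annulus (hR : 0 < R) {x : E} (hx : x ∈ ball c R) :
    ContinuousOn (fun y : E => kernelFn R (x - c) (R • dir y)) annulus ∧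
    (∀ y ∈ (annulus : Set E), 0 ≤ kernelFn R (x - c) (R • dir y) ∧
      kernelFn R (x - c) (R • dir y) ≤ (R ^ 2 - ‖x - c‖ ^ 2) * ((R - ‖x - c‖) ^ 2) ^ (-halfDim E)) ∧
    IntegrableOn (fun y : E => kernelFn R (x - c) (R • dir y)) annulus := by
  rw [mem_ball, dist_eq_norm] at hx
  have hgap : 0 < R - ‖x - c‖ := by linarith
  have hlow : ∀ y ∈ (annulus : Set E), R - ‖x - c‖ ≤ ‖x - c - R • dir y‖ := by
    intro y hy
    have h1 : ‖R • dir y‖ ≤ ‖x - c - R • dir y‖ + ‖x - c‖ := by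
      have := norm_sub_le (x - c) (x - c - R • dir y)
      rw [sub_sub_cancel] at this
      linarith [norm_sub_rev (x - c) (x - c - R • dir y)]
    rw [norm_smul_dir hR.le hy] at h1
    linarith
  have hcont : ContinuousOn (fun y : E => kernelFn R (x - c) (R • dir y)) annulus := by
    intro y hy
    have hne : ‖x - c - R • dir y‖ ^ 2 ≠ 0 := pow_ne_zero 2 (hgap.trans_le (hlow y hy)).ne'
    unfold kernelFn
    refine (continuousWithinAt_const.mul ?_)
    have h1 : ContinuousWithinAt (fun y : E => ‖x - c - R • dir y‖ ^ 2) annulus y :=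
      ((continuousWithinAt_const.sub (continuousWithinAt_const.smul (continuousOn_dir y hy))).norm).pow 2
    exact h1.rpow_const (Or.inl hne)
  have hbd : ∀ y ∈ (annulus : Set E), 0 ≤ kernelFn R (x - c) (R • dir y) ∧
      kernelFn R (x - c) (R • dir y) ≤ (R ^ 2 - ‖x - c‖ ^ 2) * ((R - ‖x - c‖) ^ 2) ^ (-halfDim E) :=
    fun y hy => ⟨kernelFn_nonneg hx.le _, kernelFn_le_of_le_norm_sub hx.le hgap (hlow y hy)⟩
  refine ⟨hcont, hbd, ?_⟩
  haveI : IsFiniteMeasure (volume.restrict (annulus : Set E)) :=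
    ⟨by rw [Measure.restrict_apply_univ]; exact volume_annulus_lt_top⟩
  refine Integrable.of_bound (hcont.aestronglyMeasurable measurableSet_annulus)
    ((R ^ 2 - ‖x - c‖ ^ 2) * ((R - ‖x - c‖) ^ 2) ^ (-halfDim E)) ?_
  rw [ae_restrict_iff' measurableSet_annulus]
  exact Eventually.of_forall fun y hy => by
    rw [Real.norm_eq_abs, abs_of_nonneg (hbd y hy).1]; exact (hbd y hy).2

/-- The full integrand `K · ψ∘s` is integrable on the annulus (`x` in the ball, `ψ` continuous
on the sphere). [folklore] -/
theorem integrableOn_integrand (hR : 0 < R) (hψ : ContinuousOn ψ (sphere c R)) {x : E}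
    (hx : x ∈ ball c R) :
    IntegrableOn (fun y : E => kernelFn R (x - c) (R • dir y) * ψ (c + R • dir y)) annulus := by
  obtain ⟨M, hM⟩ := exists_bound_sphere hψ
  obtain ⟨-, -, hK⟩ := kernel_on_annulus hR hx
  have h := Integrable.bdd_mul (c := M) hK (aestronglyMeasurable_data hR.le hψ) (by
    rw [ae_restrict_iff' measurableSet_annulus]
    exact Eventually.of_forall fun y hy => by
      rw [Real.norm_eq_abs]; exact hM _ (sph_mem_sphere c hR.le (ne_zero_of_mem_annulus hy)))
  exact h.congr (Eventually.of_forall fun y => mul_comm _ _)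

/-- **Linearity**: `P (ψ₁ - ψ₂) = P ψ₁ - P ψ₂` (for `ψᵢ` continuous on the sphere). [folklore] -/
theorem poisson_sub (hR : 0 < R) (h₁ : ContinuousOn ψ₁ (sphere c R)) (h₂ : ContinuousOn ψ₂ (sphere c R))
    (x : E) : poisson c R (ψ₁ - ψ₂) x = poisson c R ψ₁ x - poisson c R ψ₂ x := by
  by_cases hx : x ∈ ball c R
  · rw [poisson_eq_of_mem_ball _ hx, poisson_eq_of_mem_ball _ hx, poisson_eq_of_mem_ball _ hx,
      ← sub_div]
    congr 1
    unfold rawOp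
    rw [← integral_sub (integrableOn_integrand hR h₁ hx) (integrableOn_integrand hR h₂ hx)]
    refine integral_congr_ae (Eventually.of_forall fun y => ?_)
    simp only [Pi.sub_apply]; ring
  · rw [poisson_eq_self_of_notMem _ hx, poisson_eq_self_of_notMem _ hx,
      poisson_eq_self_of_notMem _ hx, Pi.sub_apply]

/-- The raw operator of a constant: `rawOp (fun _ => a) x = a · N` on the ball. [folklore] -/
theorem rawOp_const (hn : 0 < finrank ℝ E) (hR : 0 < R) (a : ℝ) {x : E} (hx : x ∈ ball c R) :
    rawOp c R (fun _ => a) x = a * normalizer c R := by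
  rw [← rawOp_one_eq_normalizer hn hR hx]
  unfold rawOp
  rw [← integral_const_mul]
  refine integral_congr_ae (Eventually.of_forall fun y => ?_)
  ring

/-- **Upper maximum-principle bound: `ψ ≤ M` on the sphere ⇒ `P ψ ≤ M` on the closed ball.**
[folklore] -/
theorem poisson_le (hn : 0 < finrank ℝ E) (hR : 0 < R) (hψ : ContinuousOn ψ (sphere c R)) {M : ℝ}
    (hM : ∀ ζ ∈ sphere c R, ψ ζ ≤ M) {x : E} (hx : x ∈ closedBall c R) : poisson c R ψ x ≤ M := by
  by_cases hxb : x ∈ ball c R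
  · have hN := normalizer_pos (c := c) hn hR
    rw [poisson_eq_of_mem_ball _ hxb, div_le_iff₀ hN, ← rawOp_const hn hR M hxb]
    unfold rawOp
    obtain ⟨-, hbd, hK⟩ := kernel_on_annulus hR hxb
    refine setIntegral_mono_on (integrableOn_integrand hR hψ hxb) (hK.mul_const M)
      measurableSet_annulus fun y hy => ?_
    exact mul_le_mul_of_nonneg_left (hM _ (sph_mem_sphere c hR.le (ne_zero_of_mem_annulus hy)))
      (hbd y hy).1
  · have hxs : x ∈ sphere c R := by
      rw [mem_closedBall] at hx; rw [mem_ball, not_lt] at hxb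
      exact mem_sphere.2 (le_antisymm hx hxb)
    rw [poisson_eq_self_of_notMem _ hxb]
    exact hM x hxs

/-- **Lower maximum-principle bound: `m ≤ ψ` on the sphere ⇒ `m ≤ P ψ` on the closed ball.**
[folklore] -/
theorem le_poisson (hn : 0 < finrank ℝ E) (hR : 0 < R) (hψ : ContinuousOn ψ (sphere c R)) {m : ℝ}
    (hm : ∀ ζ ∈ sphere c R, m ≤ ψ ζ) {x : E} (hx : x ∈ closedBall c R) : m ≤ poisson c R ψ x := by
  by_cases hxb : x ∈ ball c R
  · have hN := normalizer_pos (c := c) hn hR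
    rw [poisson_eq_of_mem_ball _ hxb, le_div_iff₀ hN, ← rawOp_const hn hR m hxb]
    unfold rawOp
    obtain ⟨-, hbd, hK⟩ := kernel_on_annulus hR hxb
    refine setIntegral_mono_on (hK.mul_const m) (integrableOn_integrand hR hψ hxb)
      measurableSet_annulus fun y hy => ?_
    exact mul_le_mul_of_nonneg_left (hm _ (sph_mem_sphere c hR.le (ne_zero_of_mem_annulus hy)))
      (hbd y hy).1
  · have hxs : x ∈ sphere c R := by
      rw [mem_closedBall] at hx; rw [mem_ball, not_lt] at hxb
      exact mem_sphere.2 (le_antisymm hx hxb)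
    rw [poisson_eq_self_of_notMem _ hxb]
    exact hm x hxs

/-- **`|ψ| ≤ M` on the sphere ⇒ `|P ψ| ≤ M` on the closed ball.** [folklore] -/
theorem abs_poisson_le (hn : 0 < finrank ℝ E) (hR : 0 < R) (hψ : ContinuousOn ψ (sphere c R))
    {M : ℝ} (hM : ∀ ζ ∈ sphere c R, |ψ ζ| ≤ M) {x : E} (hx : x ∈ closedBall c R) :
    |poisson c R ψ x| ≤ M :=
  abs_le.2 ⟨le_poisson hn hR hψ (fun ζ hζ => (abs_le.1 (hM ζ hζ)).1) hx,
    poisson_le hn hR hψ (fun ζ hζ => (abs_le.1 (hM ζ hζ)).2) hx⟩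

end Bounds

/-! ### Continuity up to the boundary -/

section Boundary

variable {c : E} {R : ℝ} {ψ : E → ℝ}

omit [InnerProductSpace ℝ E] [FiniteDimensional ℝ E] [MeasurableSpace E] [BorelSpace E] in
/-- Near a boundary point, `R² - ‖x - c‖² ≤ 2R · dist(x, ζ₀)` for `x` in the closed ball and
`ζ₀` on the sphere. [folklore] -/
theorem sq_sub_norm_sq_le {ζ₀ x : E} (hζ₀ : ζ₀ ∈ sphere c R) (hx : x ∈ closedBall c R) (hR : 0 ≤ R) :
    R ^ 2 - ‖x - c‖ ^ 2 ≤ 2 * R * dist x ζ₀ := by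
  rw [mem_sphere, dist_eq_norm] at hζ₀
  rw [mem_closedBall, dist_eq_norm] at hx
  have h1 : ‖ζ₀ - c‖ ≤ ‖ζ₀ - x‖ + ‖x - c‖ := norm_sub_le_norm_sub_add_norm_sub ζ₀ x c
  rw [hζ₀, ← dist_eq_norm, dist_comm] at h1
  have h2 : R ^ 2 - ‖x - c‖ ^ 2 = (R - ‖x - c‖) * (R + ‖x - c‖) := by ring
  rw [h2]
  have h3 : R - ‖x - c‖ ≤ dist x ζ₀ := by linarith
  have h4 : R + ‖x - c‖ ≤ 2 * R := by linarith
  have h5 : 0 ≤ R - ‖x - c‖ := by linarith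
  calc (R - ‖x - c‖) * (R + ‖x - c‖) ≤ dist x ζ₀ * (2 * R) :=
        mul_le_mul h3 h4 (by positivity) dist_nonneg
    _ = 2 * R * dist x ζ₀ := by ring

/-- **Boundary behaviour.** For `ψ` continuous on the sphere and `ζ₀` on the sphere: for every
`ε > 0` there is `δ > 0` with `|P ψ x - ψ ζ₀| < ε` for all `x` in the OPEN ball with
`dist x ζ₀ < δ` (the kernel concentrates: away from `ζ₀` it is bounded by
`(R² - ‖x-c‖²)(η/2)^{-n} ≤ 2R dist(x,ζ₀) (η/2)^{-n}`). [cite: GilbargTrudinger2001, Thm. 2.6 (proof)] -/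
theorem poisson_boundary_estimate (hn : 0 < finrank ℝ E) (hR : 0 < R)
    (hψ : ContinuousOn ψ (sphere c R)) {ζ₀ : E} (hζ₀ : ζ₀ ∈ sphere c R) {ε : ℝ} (hε : 0 < ε) :
    ∃ δ > 0, ∀ x ∈ ball c R, dist x ζ₀ < δ → |poisson c R ψ x - ψ ζ₀| < ε := by
  obtain ⟨M, hM⟩ := exists_bound_sphere hψ
  have hM0 : 0 ≤ M := (abs_nonneg _).trans (hM ζ₀ hζ₀)
  -- continuity scale of `ψ` at `ζ₀` within the sphere
  obtain ⟨η, hη, hηψ⟩ : ∃ η > 0, ∀ ζ ∈ sphere c R, dist ζ ζ₀ < η → |ψ ζ - ψ ζ₀| < ε / 2 := by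
    have := (Metric.continuousWithinAt_iff.1 (hψ ζ₀ hζ₀)) (ε / 2) (by positivity)
    obtain ⟨η, hη, h⟩ := this
    exact ⟨η, hη, fun ζ hζ hd => by have := h hζ hd; rwa [Real.dist_eq] at this⟩
  set N₀ : ℝ := normalizer c R with hN₀
  have hN : 0 < N₀ := normalizer_pos hn hR
  set V : ℝ := (volume : Measure E).real annulus with hV
  have hV0 : 0 ≤ V := measureReal_nonneg
  set Cfar : ℝ := ((η / 2) ^ 2) ^ (-halfDim E) with hCfar
  have hCfar0 : 0 < Cfar := Real.rpow_pos_of_pos (by positivity) _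
  set C₁ : ℝ := 2 * M * Cfar * V / N₀ * (2 * R) with hC₁
  have hC₁0 : 0 ≤ C₁ := by positivity
  refine ⟨min (η / 2) (ε / (2 * (C₁ + 1))), lt_min (by positivity) (by positivity), fun x hx hd => ?_⟩
  have hdη : dist x ζ₀ < η / 2 := hd.trans_le (min_le_left _ _)
  have hdε : dist x ζ₀ < ε / (2 * (C₁ + 1)) := hd.trans_le (min_le_right _ _)
  have hxc : ‖x - c‖ ≤ R := by rw [mem_ball, dist_eq_norm] at hx; exact hx.le
  -- the integral representation of the difference
  obtain ⟨hKc, hKbd, hKi⟩ := kernel_on_annulus hR hx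
  have hI := integrableOn_integrand hR hψ hx
  set s : E → E := fun y => c + R • dir y with hs
  have hsS : ∀ y ∈ (annulus : Set E), s y ∈ sphere c R := fun y hy =>
    sph_mem_sphere c hR.le (ne_zero_of_mem_annulus hy)
  have hdiff : poisson c R ψ x - ψ ζ₀ =
      N₀⁻¹ * ∫ y in annulus, kernelFn R (x - c) (R • dir y) * (ψ (s y) - ψ ζ₀) := by
    have hI1 : IntegrableOn (fun y => ψ ζ₀ * (kernelFn R (x - c) (R • dir y) * 1)) annulus :=
      (hKi.mul_const 1).const_mul _
    have h2 : ∫ y in annulus, kernelFn R (x - c) (R • dir y) * (ψ (s y) - ψ ζ₀) =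
        rawOp c R ψ x - ψ ζ₀ * rawOp c R (fun _ => 1) x := by
      unfold rawOp
      rw [← integral_const_mul, ← integral_sub hI hI1]
      refine integral_congr_ae (Eventually.of_forall fun y => ?_)
      simp only [hs]; ring
    rw [h2, rawOp_one_eq_normalizer hn hR hx, ← hN₀, poisson_eq_of_mem_ball _ hx, ← hN₀]
    field_simp
  -- pointwise bound of the integrand
  have hpt : ∀ y ∈ (annulus : Set E), |kernelFn R (x - c) (R • dir y) * (ψ (s y) - ψ ζ₀)| ≤
      ε / 2 * kernelFn R (x - c) (R • dir y) + 2 * M * ((R ^ 2 - ‖x - c‖ ^ 2) * Cfar) := by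
    intro y hy
    have hK0 := (hKbd y hy).1
    rw [abs_mul, abs_of_nonneg hK0]
    have h2M : |ψ (s y) - ψ ζ₀| ≤ 2 * M := by
      calc |ψ (s y) - ψ ζ₀| ≤ |ψ (s y)| + |ψ ζ₀| := abs_sub _ _
        _ ≤ M + M := add_le_add (hM _ (hsS y hy)) (hM _ hζ₀)
        _ = 2 * M := by ring
    have hfar0 : 0 ≤ 2 * M * ((R ^ 2 - ‖x - c‖ ^ 2) * Cfar) := by
      have : 0 ≤ R ^ 2 - ‖x - c‖ ^ 2 := by nlinarith [norm_nonneg (x - c)]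
      positivity
    by_cases hnear : dist (s y) ζ₀ < η
    · have := hηψ _ (hsS y hy) hnear
      nlinarith
    · -- far: the kernel is small
      rw [not_lt] at hnear
      have hfar : η / 2 ≤ ‖x - c - R • dir y‖ := by
        have e : x - c - R • dir y = x - s y := by
          show x - c - R • dir y = x - (c + R • dir y); abel
        rw [e, ← dist_eq_norm]
        have := dist_triangle (s y) x ζ₀
        rw [dist_comm (s y) x] at this
        linarith
      have hKle := kernelFn_le_of_le_norm_sub hxc (by positivity : (0:ℝ) < η / 2) hfar
      rw [← hCfar] at hKle
      calc kernelFn R (x - c) (R • dir y) * |ψ (s y) - ψ ζ₀|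
          ≤ ((R ^ 2 - ‖x - c‖ ^ 2) * Cfar) * (2 * M) := mul_le_mul hKle h2M (abs_nonneg _)
              (by have h0 : 0 ≤ R ^ 2 - ‖x - c‖ ^ 2 := by nlinarith [norm_nonneg (x - c)]
                  exact mul_nonneg h0 hCfar0.le)
        _ = 2 * M * ((R ^ 2 - ‖x - c‖ ^ 2) * Cfar) := by ring
        _ ≤ ε / 2 * kernelFn R (x - c) (R • dir y) + 2 * M * ((R ^ 2 - ‖x - c‖ ^ 2) * Cfar) := by
              nlinarith
  -- integrate the bound
  haveI : IsFiniteMeasure (volume.restrict (annulus : Set E)) :=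
    ⟨by rw [Measure.restrict_apply_univ]; exact volume_annulus_lt_top⟩
  have hIdiff : IntegrableOn (fun y => kernelFn R (x - c) (R • dir y) * (ψ (s y) - ψ ζ₀)) annulus := by
    have := hI.sub (hKi.mul_const (ψ ζ₀))
    refine this.congr (Eventually.of_forall fun y => ?_)
    simp only [Pi.sub_apply, hs]; ring
  have hI3 : IntegrableOn (fun y => ε / 2 * kernelFn R (x - c) (R • dir y) +
      2 * M * ((R ^ 2 - ‖x - c‖ ^ 2) * Cfar)) annulus :=
    (hKi.const_mul (ε / 2)).add (integrableOn_const volume_annulus_lt_top.ne)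
  have hbound : |∫ y in annulus, kernelFn R (x - c) (R • dir y) * (ψ (s y) - ψ ζ₀)| ≤
      ε / 2 * N₀ + 2 * M * ((R ^ 2 - ‖x - c‖ ^ 2) * Cfar) * V := by
    calc |∫ y in annulus, kernelFn R (x - c) (R • dir y) * (ψ (s y) - ψ ζ₀)|
        ≤ ∫ y in annulus, |kernelFn R (x - c) (R • dir y) * (ψ (s y) - ψ ζ₀)| := abs_integral_le_integral_abs
      _ ≤ ∫ y in annulus, (ε / 2 * kernelFn R (x - c) (R • dir y) + 2 * M * ((R ^ 2 - ‖x - c‖ ^ 2) * Cfar)) :=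
          setIntegral_mono_on hIdiff.abs hI3 measurableSet_annulus hpt
      _ = ε / 2 * N₀ + 2 * M * ((R ^ 2 - ‖x - c‖ ^ 2) * Cfar) * V := by
          rw [integral_add (hKi.const_mul _) (integrableOn_const volume_annulus_lt_top.ne),
            integral_const_mul, setIntegral_const, smul_eq_mul, hV, hN₀,
            ← rawOp_one_eq_normalizer hn hR hx]
          unfold rawOp
          simp only [mul_one]
          ring
  rw [hdiff, abs_mul, abs_of_pos (inv_pos.2 hN)]
  have hgeo := sq_sub_norm_sq_le hζ₀ (ball_subset_closedBall hx) hR.le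
  calc N₀⁻¹ * |∫ y in annulus, kernelFn R (x - c) (R • dir y) * (ψ (s y) - ψ ζ₀)|
      ≤ N₀⁻¹ * (ε / 2 * N₀ + 2 * M * ((R ^ 2 - ‖x - c‖ ^ 2) * Cfar) * V) :=
        mul_le_mul_of_nonneg_left hbound (inv_nonneg.2 hN.le)
    _ = ε / 2 + (2 * M * Cfar * V / N₀) * (R ^ 2 - ‖x - c‖ ^ 2) := by field_simp
    _ ≤ ε / 2 + (2 * M * Cfar * V / N₀) * (2 * R * dist x ζ₀) := by
        have := mul_le_mul_of_nonneg_left hgeo (by positivity : (0 : ℝ) ≤ 2 * M * Cfar * V / N₀)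
        linarith
    _ = ε / 2 + C₁ * dist x ζ₀ := by rw [hC₁]; ring
    _ ≤ ε / 2 + (C₁ + 1) * dist x ζ₀ := by
        have : C₁ * dist x ζ₀ ≤ (C₁ + 1) * dist x ζ₀ := mul_le_mul_of_nonneg_right (by linarith) dist_nonneg
        linarith
    _ < ε / 2 + (C₁ + 1) * (ε / (2 * (C₁ + 1))) := by
        have : 0 < C₁ + 1 := by linarith
        gcongr
    _ = ε := by field_simp; ring

/-- **`P ψ` is continuous on the closed ball** when `ψ` is continuous on the sphere
(`n ≥ 1`, `R > 0`). [cite: GilbargTrudinger2001, Thm. 2.6] -/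
theorem continuousOn_poisson (hn : 0 < finrank ℝ E) (hR : 0 < R) (hψ : ContinuousOn ψ (sphere c R)) :
    ContinuousOn (poisson c R ψ) (closedBall c R) := by
  intro x hx
  by_cases hxb : x ∈ ball c R
  · exact (contDiffAt_poisson hR hψ hxb).continuousAt.continuousWithinAt
  · have hxs : x ∈ sphere c R := by
      rw [mem_closedBall] at hx; rw [mem_ball, not_lt] at hxb
      exact mem_sphere.2 (le_antisymm hx hxb)
    rw [Metric.continuousWithinAt_iff]
    intro ε hε
    obtain ⟨δ₁, hδ₁, h₁⟩ := poisson_boundary_estimate hn hR hψ hxs hε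
    obtain ⟨δ₂, hδ₂, h₂⟩ := (Metric.continuousWithinAt_iff.1 (hψ x hxs)) ε hε
    refine ⟨min δ₁ δ₂, lt_min hδ₁ hδ₂, fun x' hx' hd => ?_⟩
    rw [poisson_eq_self_of_mem_sphere ψ hxs, Real.dist_eq]
    by_cases hx'b : x' ∈ ball c R
    · exact h₁ x' hx'b (hd.trans_le (min_le_left _ _))
    · have hx's : x' ∈ sphere c R := by
        rw [mem_closedBall] at hx'; rw [mem_ball, not_lt] at hx'b
        exact mem_sphere.2 (le_antisymm hx' hx'b)
      rw [poisson_eq_self_of_mem_sphere ψ hx's]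
      have := h₂ hx's (hd.trans_le (min_le_right _ _))
      rwa [Real.dist_eq] at this

end Boundary

/-! ### The interior gradient bound -/

section Gradient

variable {c : E} {R : ℝ}

/-- **Interior gradient bound**: for `0 ≤ r < R` there is `C = C(c, R, r) ≥ 0` such that
`‖D(P ψ)(x)‖ ≤ C · M` on `B̄(c, r)` whenever `|ψ| ≤ M` on the sphere (`ψ` continuous there).
[cite: GilbargTrudinger2001, Thm. 2.6 (proof)] -/
theorem exists_norm_fderiv_poisson_le (hn : 0 < finrank ℝ E) (hR : 0 < R) {r : ℝ} (hr : r < R) :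
    ∃ C : ℝ, 0 ≤ C ∧ ∀ (ψ : E → ℝ) (M : ℝ), ContinuousOn ψ (sphere c R) →
      (∀ ζ ∈ sphere c R, |ψ ζ| ≤ M) → ∀ x ∈ closedBall c r, ‖fderiv ℝ (poisson c R ψ) x‖ ≤ C * M := by
  haveI : Nontrivial E := Module.nontrivial_of_finrank_pos (R := ℝ) hn
  set δ : ℝ := (R - r) / 2 with hδ
  have hδ0 : 0 < δ := by rw [hδ]; linarith
  have hm : (0 : ℝ) < δ ^ 2 / 2 := by positivity
  have hA := contDiff_smoothKer c R hm
  obtain ⟨CA, hCA0, hCA⟩ := Literature.Analysis.Calculus.exists_forall_norm_le_of_continuous_prod (hA.continuous_fderiv (by simp)) c r 1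
  set N₀ : ℝ := normalizer c R with hN₀
  have hN : 0 < N₀ := normalizer_pos hn hR
  set V : ℝ := (volume : Measure E).real annulus with hV
  refine ⟨N₀⁻¹ * (CA * V), by positivity, fun ψ M hψ hM x hx => ?_⟩
  -- `M ≥ 0` (the sphere is nonempty)
  obtain ⟨ζ, hζ⟩ : (sphere c R).Nonempty := (NormedSpace.sphere_nonempty).2 hR.le
  have hM0 : 0 ≤ M := (abs_nonneg _).trans (hM ζ hζ)
  have hxR : x ∈ ball c (R - δ) := by
    rw [mem_closedBall] at hx; rw [mem_ball, hδ]; linarith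
  have hxb : x ∈ ball c R := by rw [mem_ball] at hxR ⊢; linarith
  haveI : IsFiniteMeasure (volume.restrict (annulus : Set E)) :=
    ⟨by rw [Measure.restrict_apply_univ]; exact volume_annulus_lt_top⟩
  have hF := integrable_data hR.le hψ hM
  -- local smooth representation of `P ψ`
  have hev : poisson c R ψ =ᶠ[𝓝 x] fun X => N₀⁻¹ • ∫ y, smoothKer c R (δ ^ 2 / 2) (X, dir y) *
      ψ (c + R • dir y) ∂(volume.restrict annulus) := by
    filter_upwards [isOpen_ball.mem_nhds hxR] with X hX
    have hXb : X ∈ ball c R := by rw [mem_ball] at hX ⊢; linarith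
    rw [poisson_eq_of_mem_ball ψ hXb, div_eq_inv_mul, smul_eq_mul, ← rawOp_eq_integral_smoothKer hδ0 hX]
  obtain ⟨hint, hderiv⟩ := hasFDerivAt_integral_kernel_mul_real hA aestronglyMeasurable_dir.1
    aestronglyMeasurable_dir.2 hF x
  have hfd := congrFun (Newtonian.fderiv_const_smul_fun N₀⁻¹ (fun X => ∫ y,
    smoothKer c R (δ ^ 2 / 2) (X, dir y) * ψ (c + R • dir y) ∂(volume.restrict annulus))) x
  rw [hev.fderiv_eq, hfd, hderiv.fderiv, norm_smul, Real.norm_eq_abs, abs_of_pos (inv_pos.2 hN),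
    mul_assoc]
  refine mul_le_mul_of_nonneg_left ?_ (inv_nonneg.2 hN.le)
  calc ‖∫ y, ψ (c + R • dir y) • (fderiv ℝ (smoothKer c R (δ ^ 2 / 2)) (x, dir y)).comp
        (ContinuousLinearMap.inl ℝ E E) ∂(volume.restrict annulus)‖
      ≤ ∫ y, ‖ψ (c + R • dir y) • (fderiv ℝ (smoothKer c R (δ ^ 2 / 2)) (x, dir y)).comp
        (ContinuousLinearMap.inl ℝ E E)‖ ∂(volume.restrict annulus) := norm_integral_le_integral_norm _
    _ ≤ ∫ _, M * CA ∂(volume.restrict (annulus : Set E)) := by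
        refine integral_mono_ae hint.norm (integrable_const _) ?_
        rw [Filter.EventuallyLE, ae_restrict_iff' measurableSet_annulus]
        refine Eventually.of_forall fun y hy => ?_
        rw [norm_smul, Real.norm_eq_abs]
        refine mul_le_mul (hM _ (sph_mem_sphere c hR.le (ne_zero_of_mem_annulus hy))) ?_ (norm_nonneg _) hM0
        refine (ContinuousLinearMap.opNorm_comp_le _ _).trans ?_
        calc ‖fderiv ℝ (smoothKer c R (δ ^ 2 / 2)) (x, dir y)‖ * ‖ContinuousLinearMap.inl ℝ E E‖
            ≤ CA * 1 := mul_le_mul (hCA x hx (dir y) (mem_closedBall_zero_iff.2 (norm_dir_le_one y)))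
                (ContinuousLinearMap.norm_inl_le_one ℝ E E)
                (norm_nonneg (ContinuousLinearMap.inl ℝ E E)) hCA0
          _ = CA := mul_one CA
    _ = CA * V * M := by
        rw [integral_const, smul_eq_mul, measureReal_restrict_apply_univ, ← hV]; ring

end Gradient

/-! ### The representation of harmonic functions -/

section Representation

variable {c : E} {R : ℝ}

/-- **Uniqueness / Poisson representation**: a function continuous on `B̄(c, R)`, `C²` at the
points of `B(c, R)` and harmonic there, coincides on `B̄(c, R)` with `P` of its boundary values
(weak maximum principle for `h - P h`; Gilbarg–Trudinger Thm. 2.6). [cite: GilbargTrudinger2001, Thm. 2.6] -/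
theorem eq_poisson_of_harmonic (hn : 0 < finrank ℝ E) (hR : 0 < R) {h : E → ℝ}
    (hc : ContinuousOn h (closedBall c R)) (h2 : ∀ x ∈ ball c R, ContDiffAt ℝ 2 h x)
    (hΔ : ∀ x ∈ ball c R, (Δ h) x = 0) : ∀ x ∈ closedBall c R, h x = poisson c R h x := by
  have hψ : ContinuousOn h (sphere c R) := hc.mono sphere_subset_closedBall
  set w : E → ℝ := h - poisson c R h with hw
  have hwc : ContinuousOn w (closure (ball c R)) := by
    rw [closure_ball c hR.ne']
    exact hc.sub (continuousOn_poisson hn hR hψ)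
  have hw2 : ∀ x ∈ ball c R, ContDiffAt ℝ 2 w x := fun x hx =>
    (h2 x hx).sub (contDiffAt_poisson hR hψ hx)
  have hwΔ : ∀ x ∈ ball c R, (Δ w) x = 0 := fun x hx => by
    rw [hw, (h2 x hx).laplacian_sub (contDiffAt_poisson hR hψ hx), hΔ x hx,
      laplacian_poisson_eq_zero hR hψ hx, sub_zero]
  have hfr : ∀ x ∈ frontier (ball c R), |w x| ≤ 0 := by
    intro x hx
    rw [frontier_ball c hR.ne'] at hx
    simp [hw, poisson_eq_self_of_mem_sphere h hx]
  intro x hx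
  have := abs_le_of_frontier_abs_le hn isOpen_ball isBounded_ball hwc hw2 hwΔ hfr x
    (by rw [closure_ball c hR.ne']; exact hx)
  have : w x = 0 := abs_nonpos_iff.1 this
  simpa [hw, sub_eq_zero] using this

end Representation

end PoissonBall

end Literature.Analysis.PDE
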